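import Mathlib
import HarnessLib
import Summits.Ventures.LatticeQCDFlow.Scoring.DeltaMethod
import Summits.Ventures.LatticeQCDFlow.Scoring.MultivariateDeltaMethod
import Summits.Ventures.LatticeQCDFlow.Scoring.TwoCodeAgreementInProbability

/-!
# An asymptotically EXACT ERROR BAR FOR A PRINTED SPEED-UP FACTOR: for two independent codes
# estimating positive figures of merit `θ_A, θ_B` (an ESS fraction, an acceptance, an integrated
# autocorrelation time) with `n` and `mₙ` draws, the studentised log-ratio
# `((log θ̂ₙ^A − log θ̂_{mₙ}^B) − log(θ_A/θ_B)) / √(V̂ₙ^A/(θ̂ₙ^A)² + V̂_{mₙ}^B/(θ̂_{mₙ}^B)²) ⇒ N(0, 1)`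

HONEST FRAMING: exact (Metropolis-corrected) sampling algorithms for lattice gauge theory;
figures of merit are autocorrelation/cost numbers at stated couplings and volumes; no
continuum-physics claim.

Venture `LatticeQCDFlow` (cell pub-lqcd), topic `Scoring`; FANOUT row 4 (`s0-u1-b`, rung S0-B)
and the venture's ladder, whose every rung is a RATIO of figures of merit between two samplers
("`≥ 10×` reduction of `τ_int(Q)` versus HMC at equal cost").  A printed speed-up factor
`θ̂^A/θ̂^B` of two independent codes deserves an error bar with nominal coverage.  This file
derives it from the tools on the tree: the one-dimensional delta method
(`Scoring/DeltaMethod`, `g = log`, `g′(θ) = θ⁻¹`) turns each one-code central limit theorem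
`√n(θ̂ₙ − θ) ⇒ N(0, s)` into `√n(log θ̂ₙ − log θ) ⇒ N(0, s/θ²)` (**`log_clt`**); the printed
squared standard error transforms as `V̂ₙ/θ̂ₙ²`, consistent IN PROBABILITY
(**`logErrorBar_tendstoInMeasure`**, by continuous mapping of the pair `(n·V̂ₙ, θ̂ₙ)`,
**`tendstoInMeasure_prodMk`**); and the two-sample theorem with in-probability error bars
(`Scoring/TwoCodeAgreementInProbability`) gives, for ANY `mₙ → ∞`,
**`logRatio_agreement_clt`**: the studentised log speed-up factor is asymptotically standard
normal, so `exp` of the symmetric interval is an asymptotically exact confidence interval for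
`θ_A/θ_B`.  NEW WORK of the cell; no definition; nothing cited as a fact (the log-transformed
two-sample z-interval is folklore).

## Content

* `tendstoInMeasure_prodMk` — pairs of in-probability convergent real sequences;
* `hasLaw_inv_mul_gaussian` — `θ⁻¹·Z ∼ N(0, s/θ²)` for `Z ∼ N(0, s)`;
* **`log_clt`**, **`logErrorBar_tendstoInMeasure`** — one code, `log`-transformed;
* **`logRatio_agreement_clt`** — THE THEOREM (two codes, sizes `n` and `mₙ`).

NOT CLAIMED: the ratio written as `log(θ̂^A/θ̂^B)` (equal to the difference of logs only once both
estimates are positive, an event of probability `→ 1` not tracked here); dependent codes (a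
flow and HMC run on shared configurations); any number of ours re-scored.
-/

noncomputable section

namespace Summit.Ventures.LatticeQCDFlow.Scoring.CardConsistency

open MeasureTheory ProbabilityTheory Finset Real Filter
open scoped Topology Function

/-! ## §1 Tools -/

section Tools

variable {Ω : Type*} [MeasurableSpace Ω] {P : Measure Ω}
variable {Ω' : Type*} [MeasurableSpace Ω'] {P' : Measure Ω'}

/-- **Pairs of in-probability convergent real sequences converge in probability** (to the
constant pair). [ours] (`‖(a, b)‖ = max ‖a‖ ‖b‖`) -/
theorem tendstoInMeasure_prodMk {U W : ℕ → Ω → ℝ} {u w : ℝ}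
    (hU : TendstoInMeasure P U atTop fun _ => u) (hW : TendstoInMeasure P W atTop fun _ => w) :
    TendstoInMeasure P (fun n ω => (U n ω, W n ω)) atTop fun _ => (u, w) := by
  rw [tendstoInMeasure_iff_norm] at hU hW ⊢
  intro ε hε
  have hsum := (hU ε hε).add (hW ε hε)
  rw [add_zero] at hsum
  refine tendsto_of_tendsto_of_tendsto_of_le_of_le' tendsto_const_nhds hsum
    (Eventually.of_forall fun n => zero_le) (Eventually.of_forall fun n => ?_)
  refine (measure_mono fun ω hω => ?_).trans (measure_union_le _ _)
  simp only [Set.mem_setOf_eq, Set.mem_union, Prod.mk_sub_mk, Prod.norm_def] at hω ⊢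
  rcases le_max_iff.1 hω with h | h
  · exact Or.inl h
  · exact Or.inr h

/-- `θ⁻¹·Z ∼ N(0, s/θ²)` for `Z ∼ N(0, s)`, `s ≥ 0`. [folklore] -/
theorem hasLaw_inv_mul_gaussian {Z : Ω' → ℝ} {s θ : ℝ} (hs : 0 ≤ s)
    (hZ : HasLaw Z (gaussianReal 0 s.toNNReal) P') :
    HasLaw (fun ω' => θ⁻¹ * Z ω') (gaussianReal 0 (s / θ ^ 2).toNNReal) P' := by
  have h := gaussianReal_const_mul hZ θ⁻¹
  have e : NNReal.mk (θ⁻¹ ^ 2) (sq_nonneg _) * s.toNNReal = (s / θ ^ 2).toNNReal := by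
    apply NNReal.eq
    simp only [NNReal.coe_mul, NNReal.coe_mk, Real.coe_toNNReal _ hs,
      Real.coe_toNNReal _ (div_nonneg hs (sq_nonneg θ)), inv_pow]
    ring
  rw [mul_zero, e] at h
  exact h

end Tools

/-! ## §2 One code, `log`-transformed -/

section OneCode

variable {Ω : Type*} [MeasurableSpace Ω] {P : Measure Ω} [IsProbabilityMeasure P]
variable {Ω' : Type*} [MeasurableSpace Ω'] {P' : Measure Ω'} [IsProbabilityMeasure P']

/-- **The `log`-transformed CLT**: `√n(θ̂ₙ − θ) ⇒ Z_A ∼ N(0, s)`, `θ > 0` ⇒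
`√n(log θ̂ₙ − log θ) ⇒ θ⁻¹·Z_A ∼ N(0, s/θ²)`. [ours] (`Scoring/DeltaMethod` with `g = log`) -/
theorem log_clt {S : ℕ → Ω → ℝ} {θ : ℝ} (hθ : 0 < θ) {ZA : Ω' → ℝ}
    (hclt : TendstoInDistribution (fun (n : ℕ) ω => Real.sqrt n * (S n ω - θ)) atTop ZA
      (fun _ => P) P') (hSm : ∀ n, Measurable (S n)) :
    TendstoInDistribution (fun (n : ℕ) ω => Real.sqrt n * (Real.log (S n ω) - Real.log θ))
      atTop (fun ω' => θ⁻¹ * ZA ω') (fun _ => P) P' :=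
  tendstoInDistribution_deltaMethod (a := fun n : ℕ => Real.sqrt n)
    (Real.tendsto_sqrt_atTop.comp tendsto_natCast_atTop_atTop) hclt
    (fun n => (hSm n).aemeasurable) (Real.hasDerivAt_log hθ.ne') Real.measurable_log

/-- **The `log`-transformed error bar is consistent in probability**:
`√n(θ̂ₙ − θ) ⇒ Z_A`, `n·V̂ₙ → s` in probability, `θ > 0` ⇒ `n·(V̂ₙ/θ̂ₙ²) → s/θ²` in
probability. [ours] (`θ̂ₙ → θ` in probability; continuous mapping of the pair) -/
theorem logErrorBar_tendstoInMeasure {S V : ℕ → Ω → ℝ} {θ s : ℝ} (hθ : 0 < θ) {ZA : Ω' → ℝ}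
    (hclt : TendstoInDistribution (fun (n : ℕ) ω => Real.sqrt n * (S n ω - θ)) atTop ZA
      (fun _ => P) P')
    (hV : TendstoInMeasure P (fun (n : ℕ) ω => (n : ℝ) * V n ω) atTop fun _ => s) :
    TendstoInMeasure P (fun (n : ℕ) ω => (n : ℝ) * (V n ω / S n ω ^ 2)) atTop
      fun _ => s / θ ^ 2 := by
  have hS : TendstoInMeasure P S atTop fun _ => θ :=
    tendstoInMeasure_of_tendstoInDistribution_scaled
      (Real.tendsto_sqrt_atTop.comp tendsto_natCast_atTop_atTop) hclt
  have hpair := tendstoInMeasure_prodMk hV hS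
  have hφ : ContinuousAt (fun z : ℝ × ℝ => z.1 / z.2 ^ 2) (s, θ) :=
    (continuous_fst.continuousAt).div ((continuous_snd.pow 2).continuousAt) (pow_ne_zero 2 hθ.ne')
  have h := tendstoInMeasure_comp_continuousAt_normed hpair hφ
  refine h.congr (fun n => Eventually.of_forall fun ω => ?_) (Eventually.of_forall fun ω => rfl)
  simp only [mul_div_assoc]

end OneCode

/-! ## §3 Two codes: the studentised log speed-up factor -/

section TwoCodes

variable {ΩA : Type*} [MeasurableSpace ΩA] {PA : Measure ΩA} [IsProbabilityMeasure PA]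
variable {ΩB : Type*} [MeasurableSpace ΩB] {PB : Measure ΩB} [IsProbabilityMeasure PB]
variable {Ω' : Type*} [MeasurableSpace Ω'] {P' : Measure Ω'} [IsProbabilityMeasure P']

/-- **THE STUDENTISED LOG SPEED-UP FACTOR IS ASYMPTOTICALLY STANDARD NORMAL.**  Two independent
codes on `(Ω_A, P_A)`, `(Ω_B, P_B)` print estimates `θ̂ₙ^X` (measurable) of POSITIVE figures of
merit `θ_X` with central limit theorems `√n(θ̂ₙ^X − θ_X) ⇒ Z_X ∼ N(0, s_X)`, `s_X > 0`, and squared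
standard errors `V̂ₙ^X` (measurable) with `n·V̂ₙ^X → s_X` in probability; code `B` is read along
any `mₙ → ∞`; `Z ∼ N(0, 1)`.  Then on `P_A ⊗ P_B`:
`((log θ̂ₙ^A − log θ_A) − (log θ̂_{mₙ}^B − log θ_B)) / √(V̂ₙ^A/(θ̂ₙ^A)² + V̂_{mₙ}^B/(θ̂_{mₙ}^B)²) ⇒ Z` —
an asymptotically exact interval for `log(θ_A/θ_B)`, the log speed-up factor. [ours] -/
theorem logRatio_agreement_clt {SA VA : ℕ → ΩA → ℝ} {SB VB : ℕ → ΩB → ℝ}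
    {θA θB sA sB : ℝ} {ZA ZB Z : Ω' → ℝ} (hθA : 0 < θA) (hθB : 0 < θB) (hsA : 0 < sA)
    (hsB : 0 < sB) (hSAm : ∀ n, Measurable (SA n)) (hVAm : ∀ n, Measurable (VA n))
    (hSBm : ∀ n, Measurable (SB n)) (hVBm : ∀ n, Measurable (VB n))
    (hcltA : TendstoInDistribution (fun (n : ℕ) ω => Real.sqrt n * (SA n ω - θA)) atTop ZA
      (fun _ => PA) P') (hZA : HasLaw ZA (gaussianReal 0 sA.toNNReal) P')
    (hcltB : TendstoInDistribution (fun (n : ℕ) ω => Real.sqrt n * (SB n ω - θB)) atTop ZB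
      (fun _ => PB) P') (hZB : HasLaw ZB (gaussianReal 0 sB.toNNReal) P')
    (hVA : TendstoInMeasure PA (fun (n : ℕ) ω => (n : ℝ) * VA n ω) atTop fun _ => sA)
    (hVB : TendstoInMeasure PB (fun (n : ℕ) ω => (n : ℝ) * VB n ω) atTop fun _ => sB)
    {m : ℕ → ℕ} (hm : Tendsto m atTop atTop) (hZ : HasLaw Z (gaussianReal 0 1) P') :
    TendstoInDistribution (fun (n : ℕ) (ω : ΩA × ΩB) =>
        ((Real.log (SA n ω.1) - Real.log θA) - (Real.log (SB (m n) ω.2) - Real.log θB))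
          / Real.sqrt (VA n ω.1 / SA n ω.1 ^ 2 + VB (m n) ω.2 / SB (m n) ω.2 ^ 2))
      atTop Z (fun _ => PA.prod PB) P' := by
  -- the `log`-transformed one-code CLTs, centred at `0`
  have hA := log_clt hθA hcltA hSAm
  have hB := log_clt hθB hcltB hSBm
  have hA' : TendstoInDistribution
      (fun (n : ℕ) ω => Real.sqrt n * ((Real.log (SA n ω) - Real.log θA) - 0)) atTop
      (fun ω' => θA⁻¹ * ZA ω') (fun _ => PA) P' := by
    simpa only [sub_zero] using hA
  have hB' : TendstoInDistribution
      (fun (n : ℕ) ω => Real.sqrt n * ((Real.log (SB n ω) - Real.log θB) - 0)) atTop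
      (fun ω' => θB⁻¹ * ZB ω') (fun _ => PB) P' := by
    simpa only [sub_zero] using hB
  -- their error bars, in probability
  have hVA' := logErrorBar_tendstoInMeasure hθA hcltA hVA
  have hVB' := logErrorBar_tendstoInMeasure hθB hcltB hVB
  have h := twoSample_agreement_clt_of_tendstoInMeasure (PA := PA) (PB := PB)
    (SA := fun n ω => Real.log (SA n ω) - Real.log θA) (VA := fun n ω => VA n ω / SA n ω ^ 2)
    (SB := fun n ω => Real.log (SB n ω) - Real.log θB) (VB := fun n ω => VB n ω / SB n ω ^ 2)
    (div_pos hsA (pow_pos hθA 2)) (div_pos hsB (pow_pos hθB 2))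
    (fun n => (Real.measurable_log.comp (hSAm n)).sub_const _)
    (fun n => (hVAm n).div ((hSAm n).pow_const 2))
    (fun n => (Real.measurable_log.comp (hSBm n)).sub_const _)
    (fun n => (hVBm n).div ((hSBm n).pow_const 2))
    hA' (hasLaw_inv_mul_gaussian hsA.le hZA) hB' (hasLaw_inv_mul_gaussian hsB.le hZB)
    hVA' hVB' hm hZ
  exact h

end TwoCodes

end Summit.Ventures.LatticeQCDFlow.Scoring.CardConsistency

end
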